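import Literature.Computability.Complexity.Williams2014Transfer
import HarnessLib

/-!
# Williams' Lemma 5.1 at the level of circuits, and succinct `ACC` witnesses

Third layer under the named fact `Williams2014_thm_3_2` (`Williams2014Transfer.lean`; R. Williams,
*Nonuniform ACC circuit lower bounds*, J. ACM 61 (2014), Thm. 3.2 with Lemma 3.1, rerun at
polynomial size in the proof of Thm. 1.1, p. 18). The nondeterministic machine `B` of that proof
guesses an `ACC` circuit `W` encoding a satisfying assignment of the succinct `3SAT` instance and
`ACC` circuits `C'ₓ, D, E` for polynomial-time computable functions (Lemma 3.1); that such `ACC`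
circuits EXIST is the sentence "By Lemma 5.1 and Theorem 5.1, it follows that SUCCINCT 3SAT has
succinct satisfying assignments that are polynomial size ACC circuits" (p. 18) together with
"since the function computed by `Cₓ` is computable in polynomial time, then even if we assume
that only `P` has `ACC` circuits, there still exists a circuit `C'ₓ` which is `ACC` and
equivalent to `Cₓ`" (p. 9). Both rest on the folklore **Lemma 5.1** (p. 17): "Let `𝒞` be any
circuit class. If `P` has non-uniform `𝒞` circuits of `S(n)^{O(1)}` size, then there is a `c > 0`
such that every `T(n)`-size circuit family (uniform or not) has an equivalent
`S(n + O(T(n) log T(n)))ᶜ`-size circuit family in `𝒞`", proved there from the `𝒞`-circuits of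
the CIRCUIT-EVAL problem: "define `C'_{|x|}(x) = D_{n₁}(C_{|x|}, x)`".

`Williams2014.lean` proves the LANGUAGE-level consequence `P ⊆ ACC0 → P/poly ⊆ ACC0`
(`Williams2014_PPoly_subset_ACC0_of_P_subset_holds`). This file proves Lemma 5.1 for `𝒞 = ACC`
AS PRINTED, circuit by circuit, with ONE modulus and ONE depth for all circuits — the form the
machine `B` needs (it guesses single circuits, and all its `ACC` circuits must share a modulus
to be combined into one `AC⁰[m]`-SAT instance):

* `AccSimulation m d q` — every `B₂`-circuit `C` on `n` inputs has an equivalent circuit over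
  `accBasis m` of `acDepth ≤ d` with at most `q(n + |C|)` gates;
* `accSimulation_of_EvalLang_mem` — **proved**: if the tree's circuit-evaluation language
  `CircEval.EvalLang` (`CircuitEval.lean`; Arora–Barak 2009, proof of Thm. 6.18) is in `AC⁰[m]`
  then `AccSimulation m d q` for some `d, q` (hard-wire the description `desc C` into the
  `AC⁰[m]` circuit for `EvalLang` at length `2n + 2 + |desc C|`, `Circuit.exists_hardwire`);
* `exists_accSimulation_of_P_subset_ACC0` — **proved**, Williams' Lemma 5.1 for `ACC`:
  `P ⊆ ACC0 → ∃ m ≥ 2, ∃ d q, AccSimulation m d q` (`EvalLang ∈ P`, `CircuitEval.lean`);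
* `AccSimulation.PPoly_subset` — **proved**: under `AccSimulation m d q` every language of
  `P/poly` has depth-`d` polynomial-size `AC⁰[m]` circuits; hence (`P ⊆ P/poly`,
  `P_subset_PPoly_holds`) `P ⊆ ACC0` already puts `P` (indeed `P/poly`) inside ONE `AC⁰[m]` at
  ONE depth (`exists_PPoly_subset_depthSizeClass_of_P_subset_ACC0`) — the uniform "`P` has
  `ACC` circuits of depth `d'`" assumed in Lemma 3.1;
* `HasSuccinctAccAssignments c L cl m d` — succinct satisfying assignments (as in
  `HasSuccinctAssignments`, `Williams2014Transfer.lean`) encoded by `accBasis m`-circuits of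
  depth `≤ d` and polynomial size; `HasSuccinctAssignments.acc` — **proved**: p. 18's sentence,
  `HasSuccinctAssignments c L cl → AccSimulation m d q → HasSuccinctAccAssignments c L cl m d`.

## Faithfulness notes

* Lemma 5.1 is printed for size functions `S`, `T` and concluded at size
  `S(n + O(T(n) log T(n)))ᶜ`; here `S`, `T` are polynomial (the case used on p. 18 and in
  Lemma 3.1) and the bound reads `q(n + T)` for a polynomial `q` depending only on the `AC⁰[m]`
  circuits of `EvalLang`: the tree's description `desc C` of a `B₂`-circuit with `T` gates on `n`
  inputs has length `≤ (T + 1)(8(n + T) + 10)` (`CircEval.length_desc_le`) instead of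
  `O(T log T)` — polynomial either way ("if `S(n)` and `T(n)` are polynomials, then
  `S(n + O(T(n) log T(n)))ᶜ` is also polynomial", p. 17).
* The depth grows by one only because the two constants fed to the hard-wired inputs are gates
  (`Circuit.exists_hardwire`); Williams does not track depth in Lemma 5.1 (for Lemma 3.1 he
  assumes "`P` has `ACC` circuits of depth `d'`", which is what `AccSimulation` provides).
* No bound on the fan-in of the simulating circuits is asserted (none is available from
  `ACC0`, whose circuits are bounded in gates only); where wires must be counted
  (`AccSatInTime`, `Williams2014.lean`) a normalisation of repeated arguments is needed first.

## References

* R. Williams, *Nonuniform ACC circuit lower bounds*, J. ACM 61(1) (2014) 2:1–2:32, Lemma 5.1,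
  §3 (p. 9), proof of Thm. 1.1 (p. 18) [Williams2014].
* S. Arora, B. Barak, *Computational Complexity: A Modern Approach*, CUP 2009, Thm. 6.18 and
  its proof (CKT-EVAL, hard-wired advice), Def. 14.3–14.4 [AroraBarak2009].
-/

namespace Literature.Computability.Complexity

open _root_.Computability Polynomial CircEval

/-! ### Arithmetic helper -/

/-- Every `ℕ`-polynomial is bounded by `n ↦ n ^ e + e` for some `e` (the tree's normal form of
polynomial bounds, cf. `AccSatInTime`, `HasSuccinctAssignments`). [folklore] -/
theorem exists_eval_le_pow_add_self (q : Polynomial ℕ) : ∃ e : ℕ, ∀ n : ℕ, q.eval n ≤ n ^ e + e := by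
  obtain ⟨c, k, hck⟩ := exists_eval_le_mul_pow_add q
  refine ⟨k + 1 + (c ^ (k + 1) + c), fun n => (hck n).trans ?_⟩
  have hmain : c * n ^ k + c ≤ n ^ (k + 1) + (c ^ (k + 1) + c) := by
    rcases le_or_gt c n with hcn | hnc
    · have : c * n ^ k ≤ n ^ (k + 1) := by
        rw [pow_succ']
        exact Nat.mul_le_mul_right _ hcn
      omega
    · have : c * n ^ k ≤ c ^ (k + 1) := by
        rw [pow_succ']
        exact Nat.mul_le_mul_left _ (Nat.pow_le_pow_left hnc.le k)
      omega
  refine hmain.trans (Nat.add_le_add ?_ (Nat.le_add_left _ _))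
  rcases Nat.eq_zero_or_pos n with rfl | hn
  · simp
  · exact Nat.pow_le_pow_right hn (Nat.le_add_right _ _)

/-! ### Simulation of `B₂`-circuits by `ACC` circuits -/

/-- `AccSimulation m d q`: *every unrestricted circuit has an equivalent `AC⁰[m]` circuit of
depth `d` and size `q(n + T)`* — for every `n` and every circuit `C` over `B₂` (fan-in `≤ 2`,
Williams' "unrestricted circuit", p. 5) with `n` inputs and `T = |C|` gates there is a circuit
`C'` over `accBasis m` on the same inputs with `acDepth C' ≤ d`, `|C'| ≤ q(n + T)` and
`C'(x) = C(x)` for all `x` (the conclusion of Williams 2014, Lemma 5.1 for `𝒞 = ACC`,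
polynomial `S`, `T`, with the modulus and the depth made explicit). [cite: Williams2014, Lemma 5.1] -/
def AccSimulation (m d : ℕ) (q : Polynomial ℕ) : Prop :=
  ∀ (n : ℕ) (C : Circuit (Fin n)), C.IsOver B2 →
    ∃ C' : Circuit (Fin n), C'.IsOver (accBasis m) ∧ C'.acDepth ≤ d ∧
      C'.size ≤ q.eval (n + C.size) ∧ ∀ x, C'.eval x = C.eval x

/-- Monotonicity of `AccSimulation` in depth and size bound. [folklore] -/
theorem AccSimulation.mono {m d d' : ℕ} {q q' : Polynomial ℕ} (h : AccSimulation m d q)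
    (hd : d ≤ d') (hq : ∀ n, q.eval n ≤ q'.eval n) : AccSimulation m d' q' := by
  intro n C hC
  obtain ⟨C', hB, hdep, hs, he⟩ := h n C hC
  exact ⟨C', hB, hdep.trans hd, hs.trans (hq _), he⟩

/-- The evaluator on `⟨ofFn u, desc C⟩` computes `C(u)` (transport of
`CircEval.evalFn_boolPair_desc` along `|ofFn u| = n`). [cite: AroraBarak2009, Thm. 6.18 (proof)] -/
theorem CircEval.evalFn_boolPair_desc_ofFn {n : ℕ} (C : Circuit (Fin n))
    (hC : ∀ g ∈ C.gates, g.arity ≤ 2) (u : Fin n → Bool) :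
    evalFn (boolPair (List.ofFn u) (desc C)) = [C.eval u] := by
  have key : ∀ (w : List Bool) (hw : w.length = n),
      evalFn (boolPair w (desc C)) = [C.eval fun i => w.get (i.cast hw.symm)] := by
    rintro w rfl
    exact evalFn_boolPair_desc w C hC
  have := key (List.ofFn u) (List.length_ofFn ..)
  simpa using this

/-- **CIRCUIT-EVAL in `AC⁰[m]` makes every circuit an `AC⁰[m]` circuit** (the proof of
Williams 2014, Lemma 5.1: "Let `{Dₙ(·,·)}` be a `S(n)ᶜ`-size circuit family for this problem.
Now let `{Cₙ}` be an arbitrary `T(n)`-size circuit family. To obtain an equivalent `𝒞`-circuit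
family … define `C'_{|x|}(x) = D_{n₁}(C_{|x|}, x)`"): if the tree's evaluation language
`EvalLang = {⟨x, d⟩ | the evaluator accepts}` has depth-`d`, size-`p` circuits over
`accBasis m`, then hard-wiring the description `desc C` (Arora–Barak 2009, proof of Thm. 6.18)
into the circuit for length `2n + 2 + |desc C|` gives an equivalent circuit over `accBasis m` of
depth `≤ d + 1` and size `≤ p(2n + 2 + |desc C|) + 2 ≤ q(n + |C|)`.
[cite: Williams2014, Lemma 5.1 (proof)] -/
theorem accSimulation_of_EvalLang_mem {m : ℕ} (h : EvalLang ∈ AC0Mod m) :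
    ∃ (d : ℕ) (q : Polynomial ℕ), AccSimulation m d q := by
  classical
  simp only [AC0Mod, DepthSizeClass, Set.mem_setOf_eq] at h
  obtain ⟨d, p, E, hE, hdec⟩ := h
  refine ⟨d + 1, p.comp (2 * X + 2 + (X + 1) * (8 * X + 10)) + 2, fun n C hC => ?_⟩
  have har : ∀ g ∈ C.gates, g.arity ≤ 2 := fun g hg => hC g hg
  set a : List Bool := desc C with ha
  let σ : Fin (2 * n + 2 + a.length) → Fin n ⊕ Bool :=
    Fin.append (Fin.append (fun i : Fin (2 * n) => Sum.inl ⟨(i : ℕ) / 2, by have := i.2; omega⟩)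
      ![Sum.inr false, Sum.inr true]) (fun j => Sum.inr (a.get j))
  obtain ⟨D, hDB, hDs, hDd, hDe⟩ := Circuit.exists_hardwire (B := accBasis m)
    (acBasis_subset_accBasis m (or_mem_acBasis 0)) (acBasis_subset_accBasis m (and_mem_acBasis 0))
    (E (2 * n + 2 + a.length)) (hE _).1 σ
  refine ⟨D, hDB, hDd.trans (Nat.add_le_add_right (hE _).2.1 1), hDs.trans ?_, fun u => ?_⟩
  · have hN : 2 * n + 2 + a.length ≤
        2 * (n + C.size) + 2 + (n + C.size + 1) * (8 * (n + C.size) + 10) := by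
      have h2 : a.length ≤ (C.size + 1) * (8 * (n + C.size) + 10) := length_desc_le C
      have h3 := Nat.mul_le_mul_right (8 * (n + C.size) + 10)
        (show C.size + 1 ≤ n + C.size + 1 by omega)
      omega
    have hq : ((2 : Polynomial ℕ) * X + 2 + (X + 1) * (8 * X + 10)).eval (n + C.size) =
        2 * (n + C.size) + 2 + (n + C.size + 1) * (8 * (n + C.size) + 10) := by
      simp [eval_add, eval_mul]
    calc (E (2 * n + 2 + a.length)).size + 2 ≤ p.eval (2 * n + 2 + a.length) + 2 :=
          Nat.add_le_add_right (hE _).2.2 2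
      _ ≤ p.eval (2 * (n + C.size) + 2 + (n + C.size + 1) * (8 * (n + C.size) + 10)) + 2 :=
          Nat.add_le_add_right (natPoly_eval_mono p hN) 2
      _ = (p.comp (2 * X + 2 + (X + 1) * (8 * X + 10)) + 2).eval (n + C.size) := by
          rw [eval_add, eval_comp, hq]
          simp
  · rw [hDe u]
    have hσ : (fun j => Sum.elim u id (σ j)) = pairVec u a.get := by
      funext j
      refine Fin.addCases (fun j₁ => ?_) (fun j₂ => ?_) j
      · refine Fin.addCases (fun i => ?_) (fun t => ?_) j₁
        · simp [σ, pairVec, Fin.append_left]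
        · simp only [σ, pairVec, Fin.append_left, Fin.append_right]
          fin_cases t <;> rfl
      · simp [σ, pairVec, Fin.append_right]
    rw [hσ, hdec.eval_eq, ofFn_pairVec, List.ofFn_get]
    have hz : boolPair (List.ofFn u) a ∈ EvalLang ↔ C.eval u = true := by
      change evalFn (boolPair (List.ofFn u) a) = [true] ↔ C.eval u = true
      rw [ha, CircEval.evalFn_boolPair_desc_ofFn C har u]
      simp
    cases hCu : C.eval u
    · exact (Set.notMem_iff_boolIndicator _ _).1 fun hmem => by simpa [hCu] using hz.1 hmem
    · exact (Set.mem_iff_boolIndicator _ _).1 (hz.2 hCu)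

/-- **Williams 2014, Lemma 5.1 for `𝒞 = ACC`** (circuit level, polynomial bounds): "If `P` has
non-uniform `𝒞` circuits of `S(n)^{O(1)}` size, then there is a `c > 0` such that every
`T(n)`-size circuit family (uniform or not) has an equivalent `S(n + O(T(n) log T(n)))ᶜ`-size
circuit family in `𝒞`." Here: if `P ⊆ ACC0` then for some modulus `m ≥ 2`, depth `d` and
polynomial `q`, every `B₂`-circuit with `n` inputs and `T` gates has an equivalent circuit over
`accBasis m` of `acDepth ≤ d` and at most `q(n + T)` gates (`AccSimulation m d q`). Proof as
printed: CIRCUIT-EVAL (`EvalLang`, in `P` by `EvalLang_mem_P`) has `ACC` circuits, into which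
the description of the given circuit is hard-wired (`accSimulation_of_EvalLang_mem`).
[cite: Williams2014, Lemma 5.1] -/
theorem exists_accSimulation_of_P_subset_ACC0 (hP : Classes.P ⊆ ACC0) :
    ∃ m : ℕ, 2 ≤ m ∧ ∃ (d : ℕ) (q : Polynomial ℕ), AccSimulation m d q := by
  have h : EvalLang ∈ ACC0 := hP EvalLang_mem_P
  simp only [ACC0, Set.mem_iUnion] at h
  obtain ⟨m, hm, hmem⟩ := h
  exact ⟨m, hm, accSimulation_of_EvalLang_mem hmem⟩

/-- Under `AccSimulation m d q`, every language of `P/poly` has depth-`d`, polynomial-size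
circuits over `accBasis m` (apply the simulation to each member of a polynomial-size
`B₂`-family; Williams 2014, Lemma 5.1: "every `T(n)`-size circuit family (uniform or not) has an
equivalent … circuit family in `𝒞`"). [cite: Williams2014, Lemma 5.1] -/
theorem AccSimulation.PPoly_subset {m d : ℕ} {q : Polynomial ℕ} (h : AccSimulation m d q) :
    PPoly ⊆ ⋃ p : Polynomial ℕ, DepthSizeClass (accBasis m) (fun _ => d) (fun n => p.eval n) := by
  intro L hL
  simp only [PPoly, Set.mem_iUnion] at hL
  obtain ⟨p, C, hC, hdec⟩ := hL
  choose C' hC' using fun n => h n (C n) (hC n).1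
  refine Set.mem_iUnion.2 ⟨q.comp (X + p), C', fun n => ⟨(hC' n).1, (hC' n).2.1, ?_⟩, fun x => ?_⟩
  · calc (C' n).size ≤ q.eval (n + (C n).size) := (hC' n).2.2.1
      _ ≤ q.eval (n + p.eval n) := natPoly_eval_mono q (Nat.add_le_add_left (hC n).2 n)
      _ = (q.comp (X + p)).eval n := by simp [eval_comp]
  · rw [(hC' _).2.2.2]
    exact hdec x

/-- Under `AccSimulation m d q` with `m ≥ 2`: `P/poly ⊆ AC⁰[m] ⊆ ACC⁰` (the language-level
Lemma 5.1 of `Williams2014.lean` recovered, with a single modulus). [cite: Williams2014, Lemma 5.1] -/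
theorem AccSimulation.PPoly_subset_AC0Mod {m d : ℕ} {q : Polynomial ℕ} (h : AccSimulation m d q) :
    PPoly ⊆ AC0Mod m := by
  intro L hL
  obtain ⟨p, hp⟩ := Set.mem_iUnion.1 (h.PPoly_subset hL)
  exact ⟨d, p, hp⟩

/-- **One modulus and one depth for all of `P`** (Williams 2014, Lemma 3.1: "Assume `P` has
`ACC` circuits of depth `d'` and size at most `S(n)`"): if `P ⊆ ACC0` then there are `m ≥ 2` and
`d` such that every language of `P/poly` — in particular (`P ⊆ P/poly`, `P_subset_PPoly_holds`)
every language of `P` — has depth-`d`, polynomial-size circuits over `accBasis m`.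
[cite: Williams2014, Lemma 5.1 and Lemma 3.1] -/
theorem exists_PPoly_subset_depthSizeClass_of_P_subset_ACC0 (hP : Classes.P ⊆ ACC0) :
    ∃ m : ℕ, 2 ≤ m ∧ ∃ d : ℕ,
      PPoly ⊆ ⋃ p : Polynomial ℕ, DepthSizeClass (accBasis m) (fun _ => d) (fun n => p.eval n) := by
  obtain ⟨m, hm, d, q, h⟩ := exists_accSimulation_of_P_subset_ACC0 hP
  exact ⟨m, hm, d, h.PPoly_subset⟩

/-- The same for `P` itself. [cite: Williams2014, Lemma 3.1 (hypothesis)] -/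
theorem exists_P_subset_depthSizeClass_of_P_subset_ACC0 (hP : Classes.P ⊆ ACC0) :
    ∃ m : ℕ, 2 ≤ m ∧ ∃ d : ℕ,
      Classes.P ⊆ ⋃ p : Polynomial ℕ, DepthSizeClass (accBasis m) (fun _ => d) (fun n => p.eval n) := by
  obtain ⟨m, hm, d, h⟩ := exists_PPoly_subset_depthSizeClass_of_P_subset_ACC0 hP
  exact ⟨m, hm, d, fun L hL => h (P_subset_PPoly_holds hL)⟩

/-! ### Succinct satisfying assignments encoded by `ACC` circuits -/

/-- Equivalent circuits encode the same assignment (`Circuit.assignment`). [folklore] -/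
theorem Circuit.assignment_congr {k : ℕ} {W W' : Circuit (Fin k)} (h : ∀ x, W'.eval x = W.eval x) :
    W'.assignment = W.assignment := by
  funext v
  simp only [Circuit.assignment, h]

/-- **Succinct satisfying assignments that are `ACC` circuits** (Williams 2014, proof of
Thm. 1.1, p. 18: "SUCCINCT 3SAT has succinct satisfying assignments that are polynomial size
`ACC` circuits"; the form of Fact 3.2 used by the machine `B` of Thm. 3.2 at polynomial size),
relative to a succinct reduction `cl` of `L` with constant `c`, a modulus `m` and a depth `d`:
there is an exponent `e` such that for every `x ∈ L` some circuit `W` over `accBasis m` with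
`k ≤ n + c log₂ n + c` inputs, `acDepth W ≤ d` and at most `nᵉ + e` gates encodes
(`Circuit.assignment`) a satisfying assignment of `succinctCNF c cl x` (cf.
`HasSuccinctAssignments`, the same with `B₂`-circuits). [cite: Williams2014, proof of Thm. 1.1 (p. 18)] -/
def HasSuccinctAccAssignments (c : ℕ) (L : Language Bool) (cl : List Bool → ℕ → Clause ℕ)
    (m d : ℕ) : Prop :=
  ∃ e : ℕ, ∀ x ∈ L, ∃ (k : ℕ) (W : Circuit (Fin k)), k ≤ succinctWidth c x.length ∧
    W.IsOver (accBasis m) ∧ W.acDepth ≤ d ∧ W.size ≤ x.length ^ e + e ∧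
      (succinctCNF c cl x).eval W.assignment = true

/-- Sanity: a succinct `ACC` satisfying assignment satisfies the presented formula. [folklore] -/
theorem HasSuccinctAccAssignments.satisfiable {c m d : ℕ} {L : Language Bool}
    {cl : List Bool → ℕ → Clause ℕ} (h : HasSuccinctAccAssignments c L cl m d) {x : List Bool}
    (hx : x ∈ L) : (succinctCNF c cl x).Satisfiable := by
  obtain ⟨e, he⟩ := h
  obtain ⟨k, W, -, -, -, -, hW⟩ := he x hx
  exact ⟨W.assignment, hW⟩

/-- `succinctWidth c n ≤ (c + 1) n + c` (`log₂ n ≤ n`). [folklore] -/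
theorem succinctWidth_le (c n : ℕ) : succinctWidth c n ≤ (c + 1) * n + c := by
  have : Nat.log 2 n ≤ n := Nat.log_le_self 2 n
  unfold succinctWidth
  nlinarith

/-- **"By Lemma 5.1 and Theorem 5.1, SUCCINCT 3SAT has succinct satisfying assignments that are
polynomial size `ACC` circuits"** (Williams 2014, proof of Thm. 1.1, p. 18): succinct satisfying
assignments by `B₂`-circuits (`HasSuccinctAssignments`, the conclusion of Thm. 5.1) become, under
`AccSimulation m d q` (Lemma 5.1), succinct satisfying assignments by circuits over `accBasis m`
of depth `≤ d` — same number of inputs, same encoded assignment, size `q(k + nᵉ + e) ≤ n^{e'} + e'`.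
[cite: Williams2014, proof of Thm. 1.1 (p. 18)] -/
theorem HasSuccinctAssignments.acc {c m d : ℕ} {q : Polynomial ℕ} {L : Language Bool}
    {cl : List Bool → ℕ → Clause ℕ} (h : HasSuccinctAssignments c L cl)
    (hS : AccSimulation m d q) : HasSuccinctAccAssignments c L cl m d := by
  obtain ⟨e, he⟩ := h
  -- a polynomial bound for `k + |W| ≤ succinctWidth c n + (n ^ e + e)`
  set r : Polynomial ℕ := (C (c + 1) * X + C c) + (X ^ e + C e) with hr
  have hr_eval : ∀ n, r.eval n = ((c + 1) * n + c) + (n ^ e + e) := fun n => by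
    simp [hr]
  obtain ⟨e', he'⟩ := exists_eval_le_pow_add_self (q.comp r)
  refine ⟨e', fun x hx => ?_⟩
  obtain ⟨k, W, hk, hWB, hWs, hWsat⟩ := he x hx
  obtain ⟨W', hW'B, hW'd, hW's, hW'e⟩ := hS k W hWB
  refine ⟨k, W', hk, hW'B, hW'd, hW's.trans ?_, ?_⟩
  · calc q.eval (k + W.size) ≤ q.eval (r.eval x.length) := natPoly_eval_mono q (by
          rw [hr_eval]
          exact Nat.add_le_add (hk.trans (succinctWidth_le c x.length)) hWs)
      _ = (q.comp r).eval x.length := by rw [eval_comp]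
      _ ≤ x.length ^ e' + e' := he' x.length
  · rwa [Circuit.assignment_congr hW'e]

end Literature.Computability.Complexity
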